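import Summits.QuantumAdvantage.AdviceFreeQNC0.WalkTubeRank
import Summits.QuantumAdvantage.AdviceFreeQNC0.BinomialTailLower
import Summits.QuantumAdvantage.AdviceFreeQNC0.DensityAxisPayoff
import Mathlib.Analysis.SpecificLimits.Normed
import HarnessLib

/-!
# Cell qa-qnc0 (rung F-Q1, route RingFrame; density axis): the TUBE BOUND in the LINEAR regime —
# `RingFailLinearWalk c` for EVERY `c > 0` from `TubeMass`, hence `T10W` and the ΣΠΣ separation
# `SPSRingFailPoly` from `TubeMass` alone

The tube bound (planner qa-qnc0-p2 ROUND-11; `tubeBound`, `WalkTubeRank.lean`, prover qa-qnc0-prover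
gen 9): for every `f ∈ M_D(P)` on `n` bits and every `D'`,
`|FAR_{D'+D}|·N_{D'}(n) ≤ 2ⁿ·#FAIL(f)`.  With `TubeMass` (`|FAR_{n/2 − C₁⌊√n⌋}| ≥ 2ⁿ/2`) and the
binomial tail at `C√n` below the middle (`binomTailLower`) it gives CONSTANT loss for every walk
strategy of degree `D ≤ ⌊√n⌋` (`tubePlan` ⇒ `WalkHardAll` ⇒ α).  This file reads the SAME bound in the
density-axis regime `n ≥ λ·D` of planner qa-qnc0-p1's `RingFailLinearWalk` (where `D` may be much
larger than `√n`): with `D' = n/2 − C₁⌊√n⌋ − D` the binomial factor is a MODERATE deviation,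
`N_{D'}(n)/2ⁿ ≥ e^{−8t²/n}/(n+1)`, `t = C₁⌊√n⌋ + D` (`choose_middle_le_exp_mul_choose`,
`HammingLayerSums.lean`), and `t²/n ≤ (C₁+1)²·D/λ` when `D > √n` — so the loss exponent is `O(D/λ)`:

* `numMonomials_moderate` — `8t ≤ n ⇒ e^{−8t²/n}·2ⁿ ≤ (n+1)·N_{n/2−t}(n)`.
* **`ringFailLinearWalk_of_tubeMass : TubeMass → ∀ c > 0, RingFailLinearWalk c`** — two regimes:
  `D ≤ ⌊√n⌋` (binomial tail, constant `c₁(C₁+2)`), `D > ⌊√n⌋` (then `n < D²`; moderate deviation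
  with `λ ≥ 16(C₁+1)²/(c·ln 2)`, and `2D² ≤ 2^{cD/2}` for `D ≥ D₀`).
* **`t10W_of_tubeMass : TubeMass → T10W`** and **`spsRingFailPoly_of_tubeMass : TubeMass →
  SPSRingFailPoly`** (`spsRingFailPoly_of_t10W`, `spsApprox`): the advice-free, non-interactive
  `QNC⁰ ⊄ ΣΠΣ_𝔽₂(poly)` separation with inverse-polynomial soundness gap — the density-axis target
  that so far hung on MULT₁ / `MassIneqAll 15` (`DensityAxisPayoff.lean`) — follows from the tube mass
  alone, BYPASSING the tensor / Mass-Inequality programme.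

`TubeMass` is kernel-checked in the cell (qn-prover g9 `tubeMass`, qn-p2 g11 `tubeMass_holds`,
reflection principle) and is being landed as this file is written; the unconditional corollaries
`t10W`, `spsRingFailPoly` are then one-liners.  The cell's theorem (prover qn-prover-3 gen 7,
2026-08-27); not in print.  WHAT THIS IS NOT: conditional on `TubeMass` here; constants absolute but
tiny; nothing about α beyond what `tubePlan` already gives; separation moves only when `TubeMass` lands.
-/

noncomputable section

namespace Summit.QuantumAdvantage.AdviceFreeQNC0

open Finset Filter
open Literature.Computability.MetaComplexity Literature.Computability.MetaComplexity.Smolensky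

/-! ### Binomial bookkeeping -/

/-- The middle binomial coefficient is at least the average: `2^n ≤ (n+1)·C(n, n/2)`. [folklore] -/
theorem two_pow_le_succ_mul_choose_middle (n : ℕ) : 2 ^ n ≤ (n + 1) * n.choose (n / 2) := by
  calc 2 ^ n = ∑ m ∈ range (n + 1), n.choose m := (Nat.sum_range_choose n).symm
    _ ≤ ∑ _m ∈ range (n + 1), n.choose (n / 2) := Finset.sum_le_sum fun m _ => Nat.choose_le_middle m n
    _ = (n + 1) * n.choose (n / 2) := by rw [sum_const, card_range, smul_eq_mul]

/-- A single binomial coefficient is at most `N_{k}(n)`. [folklore] -/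
private theorem choose_le_numMonomials'' (n k : ℕ) : n.choose k ≤ numMonomials n k := by
  unfold numMonomials
  exact Finset.single_le_sum (f := fun j => n.choose j) (fun _ _ => Nat.zero_le _)
    (mem_range.2 (Nat.lt_succ_self k))

/-- **Moderate deviations of the binomial tail**: for `8t ≤ n`,
`e^{−8t²/n}·2ⁿ ≤ (n+1)·N_{n/2 − t}(n)`. [folklore] -/
theorem numMonomials_moderate {n t : ℕ} (ht : 8 * t ≤ n) :
    Real.exp (-(8 * (t : ℝ) ^ 2 / n)) * (2 : ℝ) ^ n ≤
      ((n : ℝ) + 1) * (numMonomials n (n / 2 - t) : ℝ) := by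
  have h1 := choose_middle_le_exp_mul_choose (n := n) (s := t) (k := n / 2 - t) ht (by omega) (by omega)
  have h2 : (2 : ℝ) ^ n ≤ ((n : ℝ) + 1) * (n.choose (n / 2) : ℝ) := by
    exact_mod_cast two_pow_le_succ_mul_choose_middle n
  have h3 : (n.choose (n / 2 - t) : ℝ) ≤ (numMonomials n (n / 2 - t) : ℝ) := by
    exact_mod_cast choose_le_numMonomials'' n (n / 2 - t)
  have hE : 0 < Real.exp (-(8 * (t : ℝ) ^ 2 / n)) := Real.exp_pos _
  have hEE : Real.exp (-(8 * (t : ℝ) ^ 2 / n)) * Real.exp (8 * (t : ℝ) ^ 2 / n) = 1 := by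
    rw [← Real.exp_add, neg_add_cancel, Real.exp_zero]
  calc Real.exp (-(8 * (t : ℝ) ^ 2 / n)) * (2 : ℝ) ^ n
      ≤ Real.exp (-(8 * (t : ℝ) ^ 2 / n)) * (((n : ℝ) + 1) * (n.choose (n / 2) : ℝ)) :=
        mul_le_mul_of_nonneg_left h2 hE.le
    _ ≤ Real.exp (-(8 * (t : ℝ) ^ 2 / n)) *
        (((n : ℝ) + 1) * (Real.exp (8 * (t : ℝ) ^ 2 / n) * (n.choose (n / 2 - t) : ℝ))) :=
        mul_le_mul_of_nonneg_left (mul_le_mul_of_nonneg_left h1 (by positivity)) hE.le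
    _ = ((n : ℝ) + 1) * (n.choose (n / 2 - t) : ℝ) *
        (Real.exp (-(8 * (t : ℝ) ^ 2 / n)) * Real.exp (8 * (t : ℝ) ^ 2 / n)) := by ring
    _ = ((n : ℝ) + 1) * (n.choose (n / 2 - t) : ℝ) := by rw [hEE, mul_one]
    _ ≤ ((n : ℝ) + 1) * (numMonomials n (n / 2 - t) : ℝ) :=
        mul_le_mul_of_nonneg_left h3 (by positivity)

/-! ### The tube bound for one walk strategy: `#FAIL ≥ N_{D'}(n)/2` -/

open TubePlanProof in
/-- The tube bound and the tube mass for ONE walk strategy: if `2(C₁⌊√n⌋ + D) ≤ n` and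
`|FAR_{n/2 − C₁⌊√n⌋}| ≥ 2ⁿ/2`, then `#FAIL ≥ N_{n/2 − (C₁⌊√n⌋ + D)}(n)/2`. -/
theorem card_fail_ge_half_numMonomials {n D C₁ : ℕ} (hfit : 2 * (C₁ * Nat.sqrt n + D) ≤ n)
    (hmass : 2 ^ n ≤ 2 * (farSet n (n / 2 - C₁ * Nat.sqrt n)).card)
    (ch : ℕ) (y : Fin (n + 1) → (Fin n → Bool) → Bool) (hy : ∀ g, HasDeg (y g) D) :
    (numMonomials n (n / 2 - (C₁ * Nat.sqrt n + D)) : ℝ) / 2 ≤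
      ((univ.filter fun u : Fin n → Bool => ringWinU ch y u = false).card : ℝ) := by
  classical
  set s := Nat.sqrt n with hs
  set D' := n / 2 - C₁ * s - D with hD'
  have hsum : D' + D = n / 2 - C₁ * s := by omega
  have ht : n / 2 - (C₁ * s + D) = D' := by omega
  have hf : stratFun ch y ∈ fullSpan n D := stratFun_mem_fullSpan ch y hy
  have h₃ := tubeBound n D D' (stratFun ch y) hf
  rw [hsum] at h₃
  rw [ht]
  set FAR := (farSet n (n / 2 - C₁ * s)).card with hFAR
  set N := numMonomials n D' with hN
  set FAIL := (failSetOf (stratFun ch y)).card with hFAIL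
  have h2n : (0 : ℝ) < (2 : ℝ) ^ n := by positivity
  have h₃R : (FAR : ℝ) * N ≤ (2 : ℝ) ^ n * FAIL := by exact_mod_cast h₃
  have h₄R : (2 : ℝ) ^ n ≤ 2 * FAR := by exact_mod_cast hmass
  have hN0 : (0 : ℝ) ≤ N := Nat.cast_nonneg _
  have hfail : (N : ℝ) / 2 ≤ FAIL := by
    have step : (2 : ℝ) ^ n * ((N : ℝ) / 2) ≤ (2 : ℝ) ^ n * FAIL := by
      calc (2 : ℝ) ^ n * ((N : ℝ) / 2) = (2 : ℝ) ^ n / 2 * N := by ring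
        _ ≤ (FAR : ℝ) * N := mul_le_mul_of_nonneg_right (by linarith) hN0
        _ ≤ (2 : ℝ) ^ n * FAIL := h₃R
    exact le_of_mul_le_mul_left step h2n
  -- the fail set of `stratFun` is the strategy's fail set
  have hwin := card_win_add_card_failSetOf ch y
  have htot := Finset.card_filter_add_card_filter_not
    (s := (univ : Finset (Fin n → Bool))) (fun u => ringWinU ch y u = true)
  rw [card_univ, Fintype.card_fun, Fintype.card_bool, Fintype.card_fin] at htot
  have e : (univ.filter fun u : Fin n → Bool => ¬ ringWinU ch y u = true) =
      univ.filter fun u : Fin n → Bool => ringWinU ch y u = false := by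
    refine Finset.filter_congr fun u _ => ?_
    cases ringWinU ch y u <;> simp
  rw [e] at htot
  have hFAILeq : FAIL = (univ.filter fun u : Fin n → Bool => ringWinU ch y u = false).card := by omega
  rw [← hFAILeq]
  exact hfail

/-! ### `RingFailLinearWalk c` for every `c > 0` -/
set_option maxHeartbeats 400000 in
/-- **THE TUBE BOUND IN THE LINEAR REGIME: `TubeMass → ∀ c > 0, RingFailLinearWalk c`.** -/
theorem ringFailLinearWalk_of_tubeMass (hM : TubeMass) {c : ℝ} (hc : 0 < c) :
    RingFailLinearWalk c := by
  classical
  obtain ⟨C₁, m₀, hmass⟩ := hM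
  obtain ⟨c₁, hc₁, m₁, htail⟩ := binomTailLower (C₁ + 2)
  have hlog2 : 0 < Real.log 2 := Real.log_pos (by norm_num)
  have h2 : (0 : ℝ) < 2 := by norm_num
  -- regime A threshold: `2^{−cD} ≤ c₁/2` for `D ≥ DA`
  obtain ⟨DA, hDA⟩ : ∃ DA : ℕ, Real.logb 2 (2 / c₁) / c ≤ (DA : ℝ) :=
    ⟨Nat.ceil (Real.logb 2 (2 / c₁) / c), Nat.le_ceil _⟩
  -- regime B: `λ ≥ 8(C₁+1)`, `λ ≥ 16`, `8(C₁+1)²/λ ≤ (c·log 2)/2`; and `2D² ≤ 2^{cD/2}` for `D ≥ DB`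
  obtain ⟨K, hK⟩ : ∃ K : ℝ, K = 8 * ((C₁ : ℝ) + 1) ^ 2 := ⟨_, rfl⟩
  have hKpos : 0 < K := by rw [hK]; positivity
  obtain ⟨lam, hlam16, hlam8, hlamK⟩ : ∃ lam : ℕ, 16 ≤ lam ∧ 8 * (C₁ + 1) ≤ lam ∧
      Nat.ceil (2 * K / (c * Real.log 2)) + 1 ≤ lam :=
    ⟨max (max 16 (8 * (C₁ + 1))) (Nat.ceil (2 * K / (c * Real.log 2)) + 1),
      le_trans (le_max_left _ _) (le_max_left _ _), le_trans (le_max_right _ _) (le_max_left _ _),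
      le_max_right _ _⟩
  obtain ⟨r, hr⟩ : ∃ r : ℝ, r = (2 : ℝ) ^ (-(c / 2)) := ⟨_, rfl⟩
  have hr0 : 0 < r := by rw [hr]; exact Real.rpow_pos_of_pos h2 _
  have hr1 : r < 1 := by rw [hr]; exact Real.rpow_lt_one_of_one_lt_of_neg (by norm_num) (by linarith)
  have ht0 := tendsto_pow_const_mul_const_pow_of_lt_one 2 hr0.le hr1
  obtain ⟨DB, hDB⟩ := eventually_atTop.1 ((tendsto_order.1 ht0).2 (1 / 2) (by norm_num))
  refine ⟨lam, max (max (max m₀ m₁) (16 * (C₁ + 1) ^ 2)) (max (max DA DB) 1),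
    fun D hD n hn ch y hy => ?_⟩
  -- unpack the thresholds
  have hm₀D : m₀ ≤ D := le_trans (le_trans (le_trans (le_max_left _ _) (le_max_left _ _)) (le_max_left _ _)) hD
  have hm₁D : m₁ ≤ D := le_trans (le_trans (le_trans (le_max_right _ _) (le_max_left _ _)) (le_max_left _ _)) hD
  have h16D : 16 * (C₁ + 1) ^ 2 ≤ D := le_trans (le_trans (le_max_right _ _) (le_max_left _ _)) hD
  have hDAD : DA ≤ D := le_trans (le_trans (le_trans (le_max_left _ _) (le_max_left _ _)) (le_max_right _ _)) hD
  have hDBD : DB ≤ D := le_trans (le_trans (le_trans (le_max_right _ _) (le_max_left _ _)) (le_max_right _ _)) hD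
  have hD1 : 1 ≤ D := le_trans (le_trans (le_max_right _ _) (le_max_right _ _)) hD
  have hlam1 : 1 ≤ lam := by omega
  have hDn : D ≤ n := le_trans (by nlinarith) hn
  have hm₀n : m₀ ≤ n := le_trans hm₀D hDn
  have hm₁n : m₁ ≤ n := le_trans hm₁D hDn
  -- the cut fits: `2(C₁⌊√n⌋ + D) ≤ n`
  set s := Nat.sqrt n with hs
  have hss : s * s ≤ n := Nat.sqrt_le n
  have hC16 : 16 * (C₁ + 1) ^ 2 ≤ n := le_trans h16D hDn
  have hCs : 4 * ((C₁ + 1) * s) ≤ n := by nlinarith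
  have hD4 : 4 * D ≤ n := by nlinarith
  have hfit : 2 * (C₁ * s + D) ≤ n := by nlinarith
  -- the tube bound: `#FAIL ≥ N/2`
  have hhalf := card_fail_ge_half_numMonomials hfit (hmass n hm₀n) ch y hy
  rw [← hs] at hhalf
  set t := C₁ * s + D with htdef
  set N := numMonomials n (n / 2 - t) with hN
  set FAIL := ((univ.filter fun u : Fin n → Bool => ringWinU ch y u = false).card : ℝ) with hFAIL
  have htot : FAIL + ((univ.filter fun u : Fin n → Bool => ringWinU ch y u = true).card : ℝ) =
      (2 : ℝ) ^ n := by
    have h' := Finset.card_filter_add_card_filter_not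
      (s := (univ : Finset (Fin n → Bool))) (fun u => ringWinU ch y u = false)
    have e : (univ.filter fun u : Fin n → Bool => ¬ ringWinU ch y u = false) =
        univ.filter fun u : Fin n → Bool => ringWinU ch y u = true := by
      refine Finset.filter_congr fun u _ => ?_
      cases ringWinU ch y u <;> simp
    rw [e, card_univ, Fintype.card_fun, Fintype.card_bool, Fintype.card_fin] at h'
    rw [hFAIL]; exact_mod_cast h'
  -- it suffices to bound `N ≥ 2·2^{−cD}·2ⁿ`
  suffices hNge : 2 * ((2 : ℝ) ^ (-(c * (D : ℝ))) * (2 : ℝ) ^ n) ≤ (N : ℝ) by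
    have : (2 : ℝ) ^ (-(c * (D : ℝ))) * (2 : ℝ) ^ n ≤ FAIL := by linarith
    have e1 : (1 - (2 : ℝ) ^ (-(c * (D : ℝ)))) * (2 : ℝ) ^ n =
        (2 : ℝ) ^ n - (2 : ℝ) ^ (-(c * (D : ℝ))) * (2 : ℝ) ^ n := by ring
    rw [e1]
    linarith
  by_cases hDs : D ≤ s
  · -- regime A: `D ≤ ⌊√n⌋`, the binomial tail at `(C₁+2)√n`
    have htle : t ≤ (C₁ + 2) * s := by rw [htdef]; nlinarith
    have h₅ := htail n hm₁n t htle
    -- `2^{−cD} ≤ c₁/2`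
    have hexp : (2 : ℝ) ^ (-(c * (D : ℝ))) ≤ c₁ / 2 := by
      have hx : Real.logb 2 (2 / c₁) / c ≤ (DA : ℝ) := hDA
      have hx' : Real.logb 2 (2 / c₁) ≤ c * (D : ℝ) := by
        have hDAD' : (DA : ℝ) ≤ (D : ℝ) := by exact_mod_cast hDAD
        have := mul_le_mul_of_nonneg_left (hx.trans hDAD') hc.le
        rwa [mul_div_cancel₀ _ hc.ne'] at this
      calc (2 : ℝ) ^ (-(c * (D : ℝ))) ≤ (2 : ℝ) ^ (-Real.logb 2 (2 / c₁)) :=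
            Real.rpow_le_rpow_of_exponent_le (by norm_num) (by linarith)
        _ = c₁ / 2 := by
            rw [Real.rpow_neg h2.le, Real.rpow_logb (by norm_num) (by norm_num) (by positivity)]
            field_simp
    have h2n : (0 : ℝ) ≤ (2 : ℝ) ^ n := by positivity
    calc 2 * ((2 : ℝ) ^ (-(c * (D : ℝ))) * (2 : ℝ) ^ n) = (2 * (2 : ℝ) ^ (-(c * (D : ℝ)))) * (2 : ℝ) ^ n := by
          ring
      _ ≤ c₁ * (2 : ℝ) ^ n := mul_le_mul_of_nonneg_right (by linarith) h2n
      _ ≤ N := h₅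
  · -- regime B: `⌊√n⌋ < D`, so `n < D²`; moderate deviation
    have hsD : s < D := lt_of_not_ge hDs
    have hnD : n < D * D := by
      have := Nat.sqrt_lt.1 (show Nat.sqrt n < D by rw [← hs]; exact hsD)
      exact this
    have htD : t ≤ (C₁ + 1) * D := by
      have h1 : C₁ * s ≤ C₁ * D := Nat.mul_le_mul_left C₁ hsD.le
      calc t = C₁ * s + D := htdef
        _ ≤ C₁ * D + D := Nat.add_le_add_right h1 D
        _ = (C₁ + 1) * D := by ring
    have h8t : 8 * t ≤ n := by
      have h1 : 8 * t ≤ 8 * ((C₁ + 1) * D) := Nat.mul_le_mul_left 8 htD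
      have h2 : 8 * ((C₁ + 1) * D) = (8 * (C₁ + 1)) * D := by ring
      have h3 : (8 * (C₁ + 1)) * D ≤ lam * D := Nat.mul_le_mul_right D hlam8
      calc 8 * t ≤ 8 * ((C₁ + 1) * D) := h1
        _ = (8 * (C₁ + 1)) * D := h2
        _ ≤ lam * D := h3
        _ ≤ n := hn
    have hmod := numMonomials_moderate h8t
    -- `8t²/n ≤ K·D/λ ≤ (c log 2 / 2)·D`
    have hnpos : (0 : ℝ) < (n : ℝ) := by
      have : 0 < n := by omega
      exact_mod_cast this
    have hlamR : 2 * K / (c * Real.log 2) ≤ (lam : ℝ) - 1 := by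
      have h1 : 2 * K / (c * Real.log 2) ≤ (Nat.ceil (2 * K / (c * Real.log 2)) : ℝ) := Nat.le_ceil _
      have h2' : ((Nat.ceil (2 * K / (c * Real.log 2)) + 1 : ℕ) : ℝ) ≤ (lam : ℝ) := by
        exact_mod_cast hlamK
      push_cast at h2'
      linarith
    have hlamRpos : (0 : ℝ) < (lam : ℝ) := by exact_mod_cast (show 0 < lam by omega)
    have hKlam : K / (lam : ℝ) ≤ c * Real.log 2 / 2 := by
      rw [div_le_iff₀ hlamRpos]
      have hcl : 0 < c * Real.log 2 := mul_pos hc hlog2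
      rw [div_le_iff₀ hcl] at hlamR
      nlinarith
    have ht2 : 8 * (t : ℝ) ^ 2 / n ≤ K * (D : ℝ) / lam := by
      -- `t ≤ (C₁+1)D`, `n ≥ λD`
      have htR : (t : ℝ) ≤ ((C₁ : ℝ) + 1) * D := by exact_mod_cast htD
      have hnR : (lam : ℝ) * D ≤ n := by exact_mod_cast hn
      have hDpos : (0 : ℝ) < (D : ℝ) := by exact_mod_cast (show 0 < D by omega)
      rw [div_le_div_iff₀ hnpos hlamRpos, hK]
      have ht0 : (0 : ℝ) ≤ (t : ℝ) := Nat.cast_nonneg _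
      have h1 : (t : ℝ) ^ 2 ≤ (((C₁ : ℝ) + 1) * D) ^ 2 := pow_le_pow_left₀ ht0 htR 2
      calc 8 * (t : ℝ) ^ 2 * lam ≤ 8 * ((((C₁ : ℝ) + 1) * D) ^ 2) * lam := by
            exact mul_le_mul_of_nonneg_right (mul_le_mul_of_nonneg_left h1 (by norm_num)) hlamRpos.le
        _ = 8 * ((C₁ : ℝ) + 1) ^ 2 * D * ((lam : ℝ) * D) := by ring
        _ ≤ 8 * ((C₁ : ℝ) + 1) ^ 2 * D * n :=
            mul_le_mul_of_nonneg_left hnR (by positivity)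
    have hexp1 : (2 : ℝ) ^ (-(c * (D : ℝ) / 2)) ≤ Real.exp (-(8 * (t : ℝ) ^ 2 / n)) := by
      rw [Real.rpow_def_of_pos h2]
      refine Real.exp_le_exp.2 ?_
      have hDR : (0 : ℝ) ≤ (D : ℝ) := Nat.cast_nonneg _
      have : K * (D : ℝ) / lam ≤ c * Real.log 2 / 2 * D := by
        rw [mul_comm K, mul_div_assoc]
        calc (D : ℝ) * (K / lam) ≤ (D : ℝ) * (c * Real.log 2 / 2) := mul_le_mul_of_nonneg_left hKlam hDR
          _ = c * Real.log 2 / 2 * D := by ring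
      have : 8 * (t : ℝ) ^ 2 / n ≤ c * Real.log 2 / 2 * D := ht2.trans this
      calc Real.log 2 * -(c * (D : ℝ) / 2) = -(c * Real.log 2 / 2 * D) := by ring
        _ ≤ -(8 * (t : ℝ) ^ 2 / n) := by linarith
    -- `2D²·r^D < 1/2` with `r^D = 2^{−cD/2}`
    have hgrowth : ((D : ℝ)) ^ 2 * r ^ D < 1 / 2 := hDB D hDBD
    have hrD : r ^ D = (2 : ℝ) ^ (-(c * (D : ℝ) / 2)) := by
      rw [hr, ← Real.rpow_natCast, ← Real.rpow_mul h2.le]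
      congr 1
      ring
    rw [hrD] at hgrowth
    have hn1 : (n : ℝ) + 1 ≤ (D : ℝ) ^ 2 := by
      have h' : n + 1 ≤ D ^ 2 := by rw [sq]; exact hnD
      have h'' : ((n + 1 : ℕ) : ℝ) ≤ ((D ^ 2 : ℕ) : ℝ) := Nat.cast_le.mpr h'
      rw [Nat.cast_add, Nat.cast_one, Nat.cast_pow] at h''
      exact h''
    -- assemble: `2·2^{−cD}·2ⁿ ≤ 2^{−cD/2}·2ⁿ/D² ≤ e^{−8t²/n}·2ⁿ/(n+1) ≤ N`
    have h2n : (0 : ℝ) < (2 : ℝ) ^ n := by positivity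
    have hsq : (2 : ℝ) ^ (-(c * (D : ℝ))) = (2 : ℝ) ^ (-(c * (D : ℝ) / 2)) * (2 : ℝ) ^ (-(c * (D : ℝ) / 2)) := by
      rw [← Real.rpow_add h2]; congr 1; ring
    have hA0 : 0 < (2 : ℝ) ^ (-(c * (D : ℝ) / 2)) := Real.rpow_pos_of_pos h2 _
    have hn1pos : (0 : ℝ) < (n : ℝ) + 1 := by positivity
    have hNn : Real.exp (-(8 * (t : ℝ) ^ 2 / n)) * (2 : ℝ) ^ n / ((n : ℝ) + 1) ≤ (N : ℝ) := by
      rw [div_le_iff₀ hn1pos]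
      calc Real.exp (-(8 * (t : ℝ) ^ 2 / n)) * (2 : ℝ) ^ n ≤ ((n : ℝ) + 1) * N := hmod
        _ = (N : ℝ) * ((n : ℝ) + 1) := by ring
    have key : 2 * ((2 : ℝ) ^ (-(c * (D : ℝ))) * (2 : ℝ) ^ n) ≤
        Real.exp (-(8 * (t : ℝ) ^ 2 / n)) * (2 : ℝ) ^ n / ((n : ℝ) + 1) := by
      rw [le_div_iff₀ hn1pos, hsq]
      -- `2 · A · A · 2ⁿ · (n+1) ≤ A · 2ⁿ` given `D² · A < 1/2`, `n + 1 ≤ D²`, then `A ≤ exp(...)`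
      have hAD : (2 : ℝ) ^ (-(c * (D : ℝ) / 2)) * ((n : ℝ) + 1) ≤ 1 / 2 := by
        calc (2 : ℝ) ^ (-(c * (D : ℝ) / 2)) * ((n : ℝ) + 1)
            ≤ (2 : ℝ) ^ (-(c * (D : ℝ) / 2)) * (D : ℝ) ^ 2 := mul_le_mul_of_nonneg_left hn1 hA0.le
          _ = (D : ℝ) ^ 2 * (2 : ℝ) ^ (-(c * (D : ℝ) / 2)) := by ring
          _ ≤ 1 / 2 := hgrowth.le
      calc 2 * ((2 : ℝ) ^ (-(c * (D : ℝ) / 2)) * (2 : ℝ) ^ (-(c * (D : ℝ) / 2)) * (2 : ℝ) ^ n) * ((n : ℝ) + 1)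
          = (2 : ℝ) ^ (-(c * (D : ℝ) / 2)) * (2 : ℝ) ^ n *
              (2 * ((2 : ℝ) ^ (-(c * (D : ℝ) / 2)) * ((n : ℝ) + 1))) := by ring
        _ ≤ (2 : ℝ) ^ (-(c * (D : ℝ) / 2)) * (2 : ℝ) ^ n * 1 := by
            refine mul_le_mul_of_nonneg_left ?_ (by positivity)
            linarith
        _ = (2 : ℝ) ^ (-(c * (D : ℝ) / 2)) * (2 : ℝ) ^ n := by ring
        _ ≤ Real.exp (-(8 * (t : ℝ) ^ 2 / n)) * (2 : ℝ) ^ n :=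
            mul_le_mul_of_nonneg_right hexp1 h2n.le
    exact key.trans hNn

/-- **`TubeMass → T10W`** (take `c = 1/2`). -/
theorem t10W_of_tubeMass (hM : TubeMass) : T10W :=
  ⟨1 / 2, by norm_num, ringFailLinearWalk_of_tubeMass hM (by norm_num)⟩

/-- **`TubeMass → SPSRingFailPoly`**: the advice-free, non-interactive `QNC⁰ ⊄ ΣΠΣ_𝔽₂(poly)`
separation with inverse-polynomial soundness gap follows from the tube mass alone
(`spsRingFailPoly_of_t10W`, `spsApprox`). -/
theorem spsRingFailPoly_of_tubeMass (hM : TubeMass) : SPSRingFailPoly :=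
  spsRingFailPoly_of_t10W (t10W_of_tubeMass hM) spsApprox

end Summit.QuantumAdvantage.AdviceFreeQNC0

end
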